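import Mathlib
import HarnessLib
import Summits.HubbardSuperconductivity.HubbardSuperconductivity.Theorems.ChiralWindowCwKLChiralWindowChannelBound

/-!
# Crux `CwKLChiralWindow` (stmt-1741), line `Sketch`: the trial-free (far-channel) lower bound

For `μ ∈ (-4,0)`, a channel `χ`, the base kernel `κ = [withU] + χ₀` (`withU → χ = A1g`) and an admissible deflation with
`∫∫ (K_χ - Σ c u⊗u)² ≤ h ≤ s²`, `s ≥ 0`: `-s ≤ channelInf ε₀ μ 1 χ` (`stub_klChannelFar`).  Every negative eigenvalue `c` of the
compression to the sector has `c² ≤ h` (deflated Hilbert–Schmidt family bound of `…ChannelOps` with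
`Literature…negSqMass_le_of_family_bound`), hence Rayleigh quotients are `≥ -s` (`Literature…rayleigh_ge_neg_of_negSqMass_le`), and
pairing forms of channel states dominate Rayleigh quotients of `P`-fixed unit vectors (`kl_cb_pairingForm_ge`).
-/

noncomputable section

set_option linter.dupNamespace false

namespace Summit.HubbardSuperconductivity.HubbardSuperconductivity.Theorems

open MeasureTheory Literature.MathematicalPhysics.QuantumLattice Literature.Analysis.OperatorTheory

set_option maxHeartbeats 400000 in
/-- **The far-channel bound** (`stub_klChannelFar`): with an admissible deflation whose deflated sector square mass is
`≤ h ≤ s²` (`0 ≤ s`), the channel bottom satisfies `-s ≤ channelInf ε₀ μ 1 χ`. [folklore] -/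
theorem stub_klChannelFar : ∀ μ ∈ Set.Ioo (-4 : ℝ) 0, ∀ (χ : D4Irrep) (withU : Bool) (M : ℕ) (c : Fin M → ℝ)
    (u : Fin M → Momentum → ℝ) (h s : ℝ),
    (withU = true → χ = D4Irrep.A1g) → (∀ m, 0 ≤ c m) →
    (∀ m, MemLp (u m) 2 (fermiCurveMeasure (squareDispersion 1 0) μ)) →
    ∫ z, (d4Project χ (fun q => (if withU then 1 else 0) + lindhardFunction (squareDispersion 1 0) μ (z.1 + q)) z.2 -
        ∑ m, c m * (u m z.1 * u m z.2)) ^ 2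
        ∂(fermiCurveMeasure (squareDispersion 1 0) μ).prod (fermiCurveMeasure (squareDispersion 1 0) μ) ≤ h →
    0 ≤ s → h ≤ s ^ 2 →
    -s ≤ channelInf (squareDispersion 1 0) μ 1 χ := by
  intro μ hμ χ withU M c u h s hU hc hu hH hs hhs
  haveI : IsFiniteMeasure (fermiCurveMeasure (squareDispersion 1 0) μ) :=
    stub_klFiniteMeasure stub_klGradient stub_klHausdorffFinite μ hμ
  obtain ⟨A, P, U₁, hA, hAinner, hAsa, hAc, hAP, -, -, -, hPfix, hPrepr, -, -, -, -, -, hHS, hBpos⟩ :=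
    stub_klChannelOps μ hμ χ withU M c u hu hU hc
  obtain ⟨V, hmemV, hVc⟩ : ∃ V : Submodule ℝ (Lp ℝ 2 (fermiCurveMeasure (squareDispersion 1 0) μ)),
      (∀ v, v ∈ V ↔ P v = v) ∧ CompleteSpace V :=
    ⟨_, fun v => kl_cb_mem_ker_iff P v, (ContinuousLinearMap.isClosed_ker _).completeSpace_coe⟩
  haveI : CompleteSpace V := hVc
  have hVA : ∀ v ∈ V, A v ∈ V := by
    intro v hv
    rw [hmemV] at hv ⊢
    have h1 := congrArg (fun f => f v) hAP
    simp only [mul_apply_eq_comp] at h1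
    rw [hv] at h1
    exact h1.symm
  obtain ⟨T, hT, hTsa', hTc'⟩ := exists_compression A V hVA
  have hfam : ∀ (m : ℕ) (f : Fin m → Lp ℝ 2 (fermiCurveMeasure (squareDispersion 1 0) μ)), Orthonormal ℝ f →
      (∀ j, f j ∈ V) →
      ∑ j, ‖A (f j) - (∑ m, c m • (innerSL ℝ ((hu m).toLp (u m))).smulRight ((hu m).toLp (u m))) (f j)‖ ^ 2 ≤ h :=
    fun m f hf hfV => (hHS m f hf fun j => (hmemV _).1 (hfV j)).trans hH
  have hsq := negSqMass_le_of_family_bound (𝕜 := ℝ) hT (fun y => by simpa using hBpos y) hfam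
  have hray : ∀ y : V, -s * ‖y‖ ^ 2 ≤ inner ℝ y (T y) := fun y => by
    simpa using rayleigh_ge_neg_of_negSqMass_le (𝕜 := ℝ) (hTc' hAc) (hTsa' hAsa) hs hhs hsq y
  -- dictionary: every channel state has pairing form `≥ -s`
  have hlow : ∀ ψ, IsChannelState (squareDispersion 1 0) μ χ ψ → -s ≤ pairingForm (squareDispersion 1 0) μ 1 ψ := by
    intro ψ hψ
    have hvae : (hψ.1.toLp ψ : Momentum → ℝ) =ᵐ[fermiCurveMeasure (squareDispersion 1 0) μ] ψ := hψ.1.coeFn_toLp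
    have hvV : P (hψ.1.toLp ψ) = hψ.1.toLp ψ := hPfix ψ hψ.1 hψ.2.2
    have hvnorm : ‖hψ.1.toLp ψ‖ = 1 := by
      have h2 : ‖hψ.1.toLp ψ‖ ^ 2 = 1 := by rw [kl_bs_norm_sq_eq_integral_of_ae_eq hvae, hψ.2.1]
      exact (pow_eq_one_iff_of_nonneg (norm_nonneg _) two_ne_zero).1 h2
    have h1 := hray ⟨hψ.1.toLp ψ, (hmemV _).2 hvV⟩
    rw [(compression_inner_norm hT _).1] at h1
    change -s * ‖hψ.1.toLp ψ‖ ^ 2 ≤ inner ℝ (hψ.1.toLp ψ) (A (hψ.1.toLp ψ)) at h1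
    rw [hvnorm, one_pow, mul_one, kl_bs_inner_eq_of_ae_eq
      (fun q => (if withU then 1 else 0) + lindhardFunction (squareDispersion 1 0) μ q) A hAinner hvae] at h1
    exact h1.trans (kl_cb_pairingForm_ge hμ hU hψ).1
  have hne : ((pairingForm (squareDispersion 1 0) μ 1) '' {ψ | IsChannelState (squareDispersion 1 0) μ χ ψ}).Nonempty :=
    (nonempty_isChannelState hμ.1 hμ.2 χ).image _
  exact le_csInf hne (by rintro r ⟨ψ, hψ, rfl⟩; exact hlow ψ hψ)

end Summit.HubbardSuperconductivity.HubbardSuperconductivity.Theorems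

end
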